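import Summits.QuantumFields.BalabanUV.T4Continuum.Support.CellDivergencePlanting
import Summits.QuantumFields.BalabanUV.T4Continuum.Support.RegionGaugeResolventSplit
import Summits.QuantumFields.BalabanUV.T4Continuum.Support.RegionStarTrace
import Summits.QuantumFields.BalabanUV.T4Continuum.Support.RegionNormPairingTools

/-!
# T⁴ programme, spine node NE2 (U1a), sub-row Δ1 «NE2⁰-Dirichlet» — owner item O15-a, leaves (B)+(Bᵗ) «GAUGE-COLUMNS-TWO-LEVEL»,
# file B3a: THE TAYLOR-PLANTED COARSE SOLUTION ON THE REGION — the gradient defect `g` (King's face term + the LOW-WALL LEAK) and the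
# divergence flux `h`, with their norms charged to the DEFICIENT TRACE and the interior Hessian of the coarse solution

NE2 formalisation swarm `b2b-balaban-t4-ne2-formalise-*`, LEAF PROVER 05 (gen 9); owner rulings R35 (c) / R36 (a) (journal
`CLAIMS.log` 2026-08-20 l.22128 / l.22328); route «H⁻¹» of record (this seat, journal l.22634).  Two adjacent levels `n`, `n′ = L·n` of a
union of blocks `S` (region sites `Ω = blockReg n M S`, `Ω′ = blockReg (L·n) M S`, star bonds `starReg`).  For a coarse region scalar `ψ`
with zero extension `z = ext ψ` and coarse gradient `u = gradR ψ` (zero extension `U = ∂_n z`, `ext_gradR`):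

 * §1 compressions read on the torus: `JpR·u = JK·U` on the fine star bonds (`JstarR_mulVec`), the Taylor-planted field
   `TcR ψ := (taylorJ n L M)_{Ω′Ω}·ψ = (T z)↾Ω′` (`TcR_mulVec`), and its fine region gradient
   **`gradR_TcR_apply`**: `gradR′(TcR ψ) = [∂′(Tz) − ∂′(offMask (Tz))]↾star′` — the planted function LEAKS into the exterior cells in
   front of a LOW wall (King's cells are anchored at their origin corner: there the coarse Dirichlet wall sits `L − 1` fine spacings before
   the fine one), and truncating the leak is a gradient term on the inward bonds;
 * §2 THE GRADIENT DEFECT **`gdefR ψ := gradR′(TcR ψ) − JpR·(gradR ψ) = (gdef z − ∂′(offMask (Tz)))↾star′`** (`gdefR_apply`, by B1's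
   `GradOp_taylorJ_sub_JK_GradOp_apply`) and **`nsq_gdefR_le`**:
   `nsq (gdefR ψ) ≤ 2·d·L²·n⁻²·Hmixed n z + 2·(4d·(Ln)²)·(d·n⁻²)·Σ_{deficient b} ‖u b‖²` — King's face term by the MIXED torus Hessian of
   `z` (B1), the leak by the DEFICIENT TRACE of `u` (`nsq_offMask_taylorJ_le`: `Σ_{w∉Ω′}|Tz(w)|² ≤ d·n⁻²·Σ_def‖u‖²`);
 * §3 THE FLUX **`hR ψ := (fluxJ n L M U)↾star′`** and **`nsq_hR_le`**: `nsq (hR ψ) ≤ n⁻²·Hdiag n Ω z` (B2's pointwise bound; a fine star bond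
   whose cell is exterior is face-crossing, where the flux weight vanishes — `fluxJ_eq_zero_of_exterior_cell`).
 File B3b turns these into leaf (B): `‖B̂′ − JpR·B̂‖ ≤ Cb·n^{−1/2}` on coordinate boxes (trace inequality `RegionStarTrace.trace_deficient_le`
 + `RegionInteriorGaffney.interior_gaffney_box` + gan24's corner-free H² for the budgets; `‖∂′G′∂′ᴴ‖ ≤ 1` for the transfer).

HONEST FRAMING (T4-DAG p. 1).  `U = 1`; ONE region (any union of unit blocks here; boxes only in B3b), ONE averaging scale, finite torus;
lattice bookkeeping OURS ([folklore]); (B), (Bᵗ) NOT proved here; `hinjK` / W3 on boxes OPEN; NE2 (U1a) NOT proved; spine PROVED 0/9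
unchanged; NOT [B9] (3.23)–(3.27) as printed; NOT infinite volume / mass gap / Clay.  HONEST DEPENDENCY: continuum YM on T⁴ ⇐ BetaPertH ∧
nine spine estimates (0/9 proved); BetaPertH ⇐ (D1) ∧ (D4) ∧ CAP+tail; G-an2-4 gates asym, D1 and NE2/3/4.  No `sorry`.
-/

noncomputable section

open scoped BigOperators ComplexConjugate Matrix
open Finset

namespace Summit.QuantumFields.BalabanUV.T4Continuum.RegionTaylorColumns

open Literature.MathematicalPhysics.QuantumFieldTheory.Balaban1983to89.B5Prop11Plancherel (Tor fine unitVec)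
open Literature.MathematicalPhysics.QuantumFieldTheory.Balaban1983to89.B5Prop11Lower (nsq nsq_nonneg)
open Literature.MathematicalPhysics.QuantumFieldTheory.Balaban1983to89.B5Action121 (sdiff GradOp GradOp_mulVec sdiff_mulVec)
open Literature.MathematicalPhysics.QuantumFieldTheory.Balaban1983to89.B5Blocks16 (blockOf)
open Literature.MathematicalPhysics.QuantumFieldTheory.Balaban1983to89.B5G183RateTorus (cpt)
open Literature.MathematicalPhysics.QuantumFieldTheory.Balaban1983to89.B5G183RateTorusW (off)
open Summit.QuantumFields.BalabanUV.T4Continuum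
open Summit.QuantumFields.BalabanUV.T4Continuum.SubtypeCompression (ext ext_apply_of ext_apply_of_not nsq_ext)
open Summit.QuantumFields.BalabanUV.T4Continuum.BalabanAveragedTowerModes (par rem par_cpt_add_off rem_cpt_add_off)
open Summit.QuantumFields.BalabanUV.T4Continuum.BalabanBlockPoincare (tileEquiv)
open Summit.QuantumFields.BalabanUV.T4Continuum.KingPairingPlantedLaw (JK)
open Summit.QuantumFields.BalabanUV.T4Continuum.BlockPairingGeometry (parT par_add_unitVec)
open Summit.QuantumFields.BalabanUV.T4Continuum.LineAveragingPairing (JK_mulVec)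
open Summit.QuantumFields.BalabanUV.T4Continuum.ScalarPlantingDefect (blockOf_par)
open Summit.QuantumFields.BalabanUV.T4Continuum.RegionGaugeFixedVector (starReg gradR GradOp_apply_eq_zero_of_not_star)
open Summit.QuantumFields.BalabanUV.T4Continuum.RegionNormPairingTools (nsq_GradOp_mulVec_le)
open Summit.QuantumFields.BalabanUV.T4Continuum.RegionStarTrace (defSet mem_defSet)
open Summit.QuantumFields.BalabanUV.T4Continuum.CellTaylorPlanting (tw cJ norm_tw_le_one norm_cJ_sq_mul taylorJ taylorJ_mulVec gdef
  GradOp_taylorJ_sub_JK_GradOp_apply norm_sq_mul_nsq_GradOp_taylorJ_sub_le sum_fine_eq_sum_tile_real norm_sum_mul_sq_le)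
open Summit.QuantumFields.BalabanUV.T4Continuum.CellDivergencePlanting (fw fluxJ norm_fluxJ_le)
open Summit.QuantumFields.BalabanUV.Beta.GAN24.DirichletBoxCompression (toBlock_mulVec')
open Summit.QuantumFields.BalabanUV.Beta.GAN24.DirichletBoxTrace (blockReg)
open Summit.QuantumFields.BalabanUV.Beta.GAN24.DirichletBoxRegularity (Pdir Pdir_mulVec Hdiag Hmixed)

variable {d : ℕ} (n L : ℕ) [NeZero n] [NeZero L] (M : Fin d → ℕ) [hM : ∀ μ, NeZero (M μ)] (S : Tor M → Prop) [DecidablePred S]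

omit [NeZero n] [NeZero L] hM [DecidablePred S] in
/-- a sum of nonnegative terms over a subtype is at most the full sum. [folklore] -/
theorem sum_subtype_le_sum' {α : Type*} [Fintype α] (q : α → Prop) [DecidablePred q] {F : α → ℝ} (hF : ∀ b, 0 ≤ F b) :
    ∑ b : {x // q x}, F b ≤ ∑ b, F b := by
  rw [← Fintype.sum_subtype_add_sum_subtype q F]
  exact le_add_of_nonneg_right (Finset.sum_nonneg fun b _ => hF _)

/-! ## §1 The compressions read on the torus -/

/-- the coarse gradient `u = gradR ψ`, zero-extended to all bonds, IS the torus gradient of the zero extension `z = ext ψ`. [folklore] -/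
theorem ext_gradR (ψ : {x // blockReg n M S x} → ℂ) :
    ext (starReg n M S) (gradR n M S *ᵥ ψ) = GradOp (fine n M) (n : ℂ) *ᵥ ext (blockReg n M S) ψ := by
  funext b
  by_cases hb : starReg n M S b
  · rw [ext_apply_of _ _ ⟨b, hb⟩]
    unfold gradR
    rw [toBlock_mulVec']
  · rw [ext_apply_of_not _ _ hb]
    simp only [Matrix.mulVec, dotProduct]
    symm
    refine Finset.sum_eq_zero fun y _ => ?_
    by_cases hy : blockReg n M S y
    · rw [GradOp_apply_eq_zero_of_not_star n M S hb hy, zero_mul]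
    · rw [ext_apply_of_not _ _ hy, mul_zero]

/-- KING's COMPRESSED 1-FORM PLANTING between the star bonds of two adjacent levels `n`, `L·n` (the tower's `JpR` at any level, spelled on
`n`). [folklore] -/
def JstarR : Matrix {b // starReg (L * n) M S b} {b // starReg n M S b} ℂ := (JK n L M).toBlock (starReg (L * n) M S) (starReg n M S)

/-- `(JpR·u)(b′) = (JK·ext u)(b′)` on every fine star bond. [folklore] -/
theorem JstarR_mulVec (u : {b // starReg n M S b} → ℂ) (b' : {b // starReg (L * n) M S b}) :
    (JstarR n L M S *ᵥ u) b' = (JK n L M *ᵥ ext (starReg n M S) u) b'.1 := by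
  unfold JstarR
  rw [toBlock_mulVec']

/-- THE COMPRESSED TAYLOR PLANTING `TcR = T_{Ω′Ω}`. [folklore] -/
def TcR : Matrix {x // blockReg (L * n) M S x} {x // blockReg n M S x} ℂ := (taylorJ n L M).toBlock (blockReg (L * n) M S) (blockReg n M S)

/-- `(TcR ψ)(x′) = (T·ext ψ)(x′)` on `Ω′`. [folklore] -/
theorem TcR_mulVec (ψ : {x // blockReg n M S x} → ℂ) (a : {x // blockReg (L * n) M S x}) :
    (TcR n L M S *ᵥ ψ) a = (taylorJ n L M *ᵥ ext (blockReg n M S) ψ) a.1 := by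
  unfold TcR
  rw [toBlock_mulVec']

/-- the mask of the exterior: `offMask w = w` off `Ω′`, `0` on `Ω′`. [folklore] -/
def offMask (w : Tor (fine (L * n) M) → ℂ) : Tor (fine (L * n) M) → ℂ := fun x => if blockReg (L * n) M S x then 0 else w x

/-- `ext′(TcR ψ) = T z − offMask (T z)` (truncating the leak). [folklore] -/
theorem ext_TcR (ψ : {x // blockReg n M S x} → ℂ) :
    ext (blockReg (L * n) M S) (TcR n L M S *ᵥ ψ)
      = taylorJ n L M *ᵥ ext (blockReg n M S) ψ - offMask n L M S (taylorJ n L M *ᵥ ext (blockReg n M S) ψ) := by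
  funext x
  rw [Pi.sub_apply]
  unfold offMask
  by_cases hx : blockReg (L * n) M S x
  · rw [ext_apply_of _ _ ⟨x, hx⟩, TcR_mulVec, if_pos hx, sub_zero]
  · rw [ext_apply_of_not _ _ hx, if_neg hx, sub_self]

/-- **the fine region gradient of the Taylor-planted field**: `gradR′(TcR ψ) = [∂′(Tz) − ∂′(offMask(Tz))]↾star′`. [folklore] -/
theorem gradR_TcR_apply (ψ : {x // blockReg n M S x} → ℂ) (b' : {b // starReg (L * n) M S b}) :
    (gradR (L * n) M S *ᵥ (TcR n L M S *ᵥ ψ)) b'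
      = (GradOp (fine (L * n) M) (((L * n : ℕ) : ℂ)) *ᵥ (taylorJ n L M *ᵥ ext (blockReg n M S) ψ)) b'.1
        - (GradOp (fine (L * n) M) (((L * n : ℕ) : ℂ)) *ᵥ offMask n L M S (taylorJ n L M *ᵥ ext (blockReg n M S) ψ)) b'.1 := by
  have h := congrFun (ext_gradR (L * n) M S (TcR n L M S *ᵥ ψ)) b'.1
  rw [ext_apply_of _ _ b'] at h
  rw [h, ext_TcR, Matrix.mulVec_sub, Pi.sub_apply]

/-! ## §2 The gradient defect `g` and its size -/

/-- **THE GRADIENT DEFECT** `gdefR ψ := gradR′(TcR ψ) − JpR·(gradR ψ)` on the fine star bonds. [folklore] -/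
def gdefR (ψ : {x // blockReg n M S x} → ℂ) : {b // starReg (L * n) M S b} → ℂ :=
  gradR (L * n) M S *ᵥ (TcR n L M S *ᵥ ψ) - JstarR n L M S *ᵥ (gradR n M S *ᵥ ψ)

/-- `gdefR ψ = (gdef z − ∂′(offMask(Tz)))↾star′`: King's face term of B1 plus the truncated leak. [folklore] -/
theorem gdefR_apply (ψ : {x // blockReg n M S x} → ℂ) (b' : {b // starReg (L * n) M S b}) :
    gdefR n L M S ψ b' = gdef n L M (n : ℂ) (ext (blockReg n M S) ψ) b'.1.1 b'.1.2
      - (GradOp (fine (L * n) M) (((L * n : ℕ) : ℂ)) *ᵥ offMask n L M S (taylorJ n L M *ᵥ ext (blockReg n M S) ψ)) b'.1 := by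
  unfold gdefR
  rw [Pi.sub_apply, gradR_TcR_apply, JstarR_mulVec, ext_gradR, ← GradOp_taylorJ_sub_JK_GradOp_apply]
  push_cast
  ring

/-- the planted function at an EXTERIOR fine site `w` (its cell `par w ∉ Ω`, where `z = 0`): `(Tz)(w) = cJ·Σ_μ tw_μ(w)·z(par w + e_μ)`, so
`‖(Tz)(w)‖² ≤ ‖cJ‖²·d·Σ_μ ‖z(par w + e_μ)‖²`. [folklore] -/
theorem norm_taylorJ_ext_sq_le_of_exterior (ψ : {x // blockReg n M S x} → ℂ) {w : Tor (fine (L * n) M)}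
    (hw : ¬ blockReg n M S (par n L M w)) :
    ‖(taylorJ n L M *ᵥ ext (blockReg n M S) ψ) w‖ ^ 2
      ≤ ‖cJ d L‖ ^ 2 * (d * ∑ μ, ‖ext (blockReg n M S) ψ (par n L M w + unitVec (fine n M) μ)‖ ^ 2) := by
  rw [taylorJ_mulVec, ext_apply_of_not _ _ hw, zero_add, norm_mul, mul_pow]
  refine mul_le_mul_of_nonneg_left ?_ (sq_nonneg _)
  simp_rw [sub_zero]
  have h := norm_sum_mul_sq_le Finset.univ (fun μ => tw n L M w μ) (fun μ => ext (blockReg n M S) ψ (par n L M w + unitVec (fine n M) μ))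
    (norm_tw_le_one n L M w)
  rwa [Finset.card_univ, Fintype.card_fin] at h

/-- a neighbour value `z(Y + e_μ)` seen from an EXTERIOR coarse site `Y ∉ Ω` is `n⁻¹` times the coarse gradient on the bond `(Y, μ)`,
which is DEFICIENT whenever the value is non-zero. [folklore] -/
theorem norm_ext_add_unitVec_eq (ψ : {x // blockReg n M S x} → ℂ) {Y : Tor (fine n M)} (hY : ¬ blockReg n M S Y) (μ : Fin d) :
    ‖ext (blockReg n M S) ψ (Y + unitVec (fine n M) μ)‖
      = (n : ℝ)⁻¹ * ‖(GradOp (fine n M) (n : ℂ) *ᵥ ext (blockReg n M S) ψ) (Y, μ)‖ := by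
  have hn : (n : ℝ) ≠ 0 := by exact_mod_cast NeZero.ne n
  rw [GradOp_mulVec, sdiff_mulVec, ext_apply_of_not _ _ hY, sub_zero, norm_mul, Complex.norm_natCast, ← mul_assoc, inv_mul_cancel₀ hn,
    one_mul]

/-- **THE LEAK IS A DEFICIENT TRACE**: `Σ_{w ∉ Ω′} ‖(Tz)(w)‖² ≤ d·n⁻²·Σ_{b deficient} ‖u b‖²`. [folklore] -/
theorem nsq_offMask_taylorJ_le (ψ : {x // blockReg n M S x} → ℂ) :
    nsq (offMask n L M S (taylorJ n L M *ᵥ ext (blockReg n M S) ψ))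
      ≤ d * ((n : ℝ) ^ 2)⁻¹ * ∑ b ∈ defSet n M S, ‖(gradR n M S *ᵥ ψ) b‖ ^ 2 := by
  have hRd : ‖cJ d L‖ ^ 2 * (L : ℝ) ^ d = 1 := norm_cJ_sq_mul (d := d) L
  have hn : (0 : ℝ) < n := by exact_mod_cast Nat.pos_of_ne_zero (NeZero.ne n)
  set z := ext (blockReg n M S) ψ with hz
  set U := GradOp (fine n M) (n : ℂ) *ᵥ z with hU
  -- pointwise, cell by cell
  have hpt : ∀ w : Tor (fine (L * n) M), ‖offMask n L M S (taylorJ n L M *ᵥ z) w‖ ^ 2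
      ≤ ‖cJ d L‖ ^ 2 * (d * ∑ μ, if blockReg n M S (par n L M w) then 0 else ((n : ℝ) ^ 2)⁻¹ * ‖U (par n L M w, μ)‖ ^ 2) := by
    intro w
    unfold offMask
    by_cases hw : blockReg (L * n) M S w
    · rw [if_pos hw, norm_zero]
      have : 0 ≤ ‖cJ d L‖ ^ 2 * (d * ∑ μ, if blockReg n M S (par n L M w) then (0 : ℝ) else ((n : ℝ) ^ 2)⁻¹ * ‖U (par n L M w, μ)‖ ^ 2) :=
        mul_nonneg (sq_nonneg _) (mul_nonneg (Nat.cast_nonneg _) (Finset.sum_nonneg fun μ _ => by split_ifs <;> positivity))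
      simpa using this
    · rw [if_neg hw]
      have hw' : ¬ blockReg n M S (par n L M w) := by
        intro h; apply hw
        show S (blockOf (L * n) M w)
        rw [← blockOf_par]; exact h
      refine (norm_taylorJ_ext_sq_le_of_exterior n L M S ψ hw').trans (le_of_eq ?_)
      congr 2
      refine Finset.sum_congr rfl fun μ _ => ?_
      rw [if_neg hw', norm_ext_add_unitVec_eq n M S ψ hw' μ, mul_pow, inv_pow]
  -- sum over the fine torus, tiled by cells
  calc nsq (offMask n L M S (taylorJ n L M *ᵥ z))
      = ∑ w, ‖offMask n L M S (taylorJ n L M *ᵥ z) w‖ ^ 2 := rfl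
    _ ≤ ∑ w, ‖cJ d L‖ ^ 2 * (d * ∑ μ, if blockReg n M S (par n L M w) then 0 else ((n : ℝ) ^ 2)⁻¹ * ‖U (par n L M w, μ)‖ ^ 2) :=
        Finset.sum_le_sum fun w _ => hpt w
    _ = ∑ Y : Tor (fine n M), ∑ _j : Fin d → Fin L, ‖cJ d L‖ ^ 2
          * (d * ∑ μ, if blockReg n M S Y then 0 else ((n : ℝ) ^ 2)⁻¹ * ‖U (Y, μ)‖ ^ 2) := by
        rw [sum_fine_eq_sum_tile_real n L M]
        refine Finset.sum_congr rfl fun Y _ => Finset.sum_congr rfl fun j _ => ?_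
        rw [par_cpt_add_off]
    _ = ∑ Y : Tor (fine n M), d * ∑ μ, (if blockReg n M S Y then 0 else ((n : ℝ) ^ 2)⁻¹ * ‖U (Y, μ)‖ ^ 2) := by
        refine Finset.sum_congr rfl fun Y _ => ?_
        rw [Finset.sum_const, Finset.card_univ, Fintype.card_fun, Fintype.card_fin, Fintype.card_fin, nsmul_eq_mul, Nat.cast_pow,
          ← mul_assoc, mul_comm ((L : ℝ) ^ d), hRd, one_mul]
    _ = d * ((n : ℝ) ^ 2)⁻¹ * ∑ b : Tor (fine n M) × Fin d, (if blockReg n M S b.1 then 0 else ‖U b‖ ^ 2) := by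
        rw [Fintype.sum_prod_type, Finset.mul_sum]
        refine Finset.sum_congr rfl fun Y _ => ?_
        rw [Finset.mul_sum, Finset.mul_sum]
        refine Finset.sum_congr rfl fun μ _ => ?_
        dsimp only
        split_ifs <;> ring
    _ = d * ((n : ℝ) ^ 2)⁻¹ * ∑ b ∈ defSet n M S, ‖(gradR n M S *ᵥ ψ) b‖ ^ 2 := by
        congr 1
        -- the masked torus sum is the deficient sum: `U` vanishes off the star bonds and is `ext u` on them
        have hUext : U = ext (starReg n M S) (gradR n M S *ᵥ ψ) := by rw [hU, hz, ext_gradR]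
        rw [← Fintype.sum_subtype_add_sum_subtype (starReg n M S)
          (fun b : Tor (fine n M) × Fin d => if blockReg n M S b.1 then (0 : ℝ) else ‖U b‖ ^ 2)]
        have h0 : ∑ b : {b // ¬ starReg n M S b}, (if blockReg n M S b.1.1 then (0 : ℝ) else ‖U b.1‖ ^ 2) = 0 :=
          Finset.sum_eq_zero fun b _ => by
            rw [hUext, ext_apply_of_not _ _ b.2, norm_zero]; simp
        rw [h0, add_zero, defSet, Finset.sum_filter]
        refine Finset.sum_congr rfl fun b _ => ?_
        rw [hUext, ext_apply_of _ _ b]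
        by_cases hb : blockReg n M S b.1.1
        · rw [if_pos hb, if_neg (not_not.mpr hb)]
        · rw [if_neg hb, if_pos hb]

/-- **THE SIZE OF THE GRADIENT DEFECT**:
`nsq (gdefR ψ) ≤ 2·(d·L²·n⁻²·Hmixed n z) + 2·(4d·(Ln)²·(d·n⁻²·Σ_def ‖u‖²))` — King's face term by the mixed torus Hessian of the zero
extension (B1), the truncated leak by the deficient trace of the coarse gradient. [folklore] -/
theorem nsq_gdefR_le (ψ : {x // blockReg n M S x} → ℂ) :
    nsq (gdefR n L M S ψ)
      ≤ 2 * (d * (L : ℝ) ^ 2 * ((n : ℝ) ^ 2)⁻¹ * Hmixed (n : ℂ) (ext (blockReg n M S) ψ))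
        + 2 * (4 * d * ((L * n : ℕ) : ℝ) ^ 2 * (d * ((n : ℝ) ^ 2)⁻¹ * ∑ b ∈ defSet n M S, ‖(gradR n M S *ᵥ ψ) b‖ ^ 2)) := by
  have hn : (0 : ℝ) < n := by exact_mod_cast Nat.pos_of_ne_zero (NeZero.ne n)
  set z := ext (blockReg n M S) ψ with hz
  set A : Tor (fine (L * n) M) × Fin d → ℂ := fun b => gdef n L M (n : ℂ) z b.1 b.2 with hA
  set B : Tor (fine (L * n) M) × Fin d → ℂ :=
    GradOp (fine (L * n) M) (((L * n : ℕ) : ℂ)) *ᵥ offMask n L M S (taylorJ n L M *ᵥ z) with hB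
  -- `nsq (gdefR ψ) ≤ nsq over all fine bonds of A − B ≤ 2 nsq A + 2 nsq B`
  have h1 : nsq (gdefR n L M S ψ) ≤ nsq (A - B) := by
    have e : nsq (gdefR n L M S ψ) = ∑ b' : {b // starReg (L * n) M S b}, ‖(A - B) b'.1‖ ^ 2 := by
      unfold nsq; refine Finset.sum_congr rfl fun b' _ => ?_; rw [gdefR_apply, Pi.sub_apply]
    rw [e]
    exact sum_subtype_le_sum' (starReg (L * n) M S) (F := fun b => ‖(A - B) b‖ ^ 2) fun _ => by positivity
  have h2 : nsq (A - B) ≤ 2 * nsq A + 2 * nsq B := by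
    unfold nsq
    rw [Finset.mul_sum, Finset.mul_sum, ← Finset.sum_add_distrib]
    refine Finset.sum_le_sum fun b _ => ?_
    rw [Pi.sub_apply]
    have h3 : ‖A b - B b‖ ^ 2 ≤ (‖A b‖ + ‖B b‖) ^ 2 := pow_le_pow_left₀ (norm_nonneg _) (norm_sub_le (A b) (B b)) 2
    nlinarith [h3, sq_nonneg (‖A b‖ - ‖B b‖)]
  -- King's face term
  have hA' : nsq A ≤ d * (L : ℝ) ^ 2 * ((n : ℝ) ^ 2)⁻¹ * Hmixed (n : ℂ) z := by
    have h := norm_sq_mul_nsq_GradOp_taylorJ_sub_le n L M (n : ℂ) z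
    rw [CellTaylorPlanting.GradOp_taylorJ_sub_JK_GradOp] at h
    rw [Complex.norm_natCast] at h
    have hn2 : (0 : ℝ) < (n : ℝ) ^ 2 := by positivity
    rw [← hA] at h
    calc nsq A = ((n : ℝ) ^ 2)⁻¹ * ((n : ℝ) ^ 2 * nsq A) := by field_simp
      _ ≤ ((n : ℝ) ^ 2)⁻¹ * (d * (L : ℝ) ^ 2 * Hmixed (n : ℂ) z) := mul_le_mul_of_nonneg_left h (inv_nonneg.mpr hn2.le)
      _ = _ := by ring
  -- the leak
  have hB' : nsq B ≤ 4 * d * ((L * n : ℕ) : ℝ) ^ 2 * (d * ((n : ℝ) ^ 2)⁻¹ * ∑ b ∈ defSet n M S, ‖(gradR n M S *ᵥ ψ) b‖ ^ 2) := by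
    refine (nsq_GradOp_mulVec_le (L * n) M _).trans ?_
    exact mul_le_mul_of_nonneg_left (nsq_offMask_taylorJ_le n L M S ψ) (by positivity)
  linarith [h1, h2, hA', hB']

/-! ## §3 The flux `h` and its size -/

omit [DecidablePred S] in
/-- a fine star bond whose CELL is exterior is a face-crossing bond (its far end lies in the next cell), so the flux weight vanishes
there. [folklore] -/
theorem fluxJ_eq_zero_of_exterior_cell (U : Tor (fine n M) × Fin d → ℂ) {b' : Tor (fine (L * n) M) × Fin d}
    (hb : starReg (L * n) M S b') (hx : ¬ blockReg n M S (par n L M b'.1)) : fluxJ n L M U b' = 0 := by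
  -- `b'.1` is exterior (same cell ⇒ same block), so `b'.1 + e_ν ∈ Ω′`; if the bond did not cross a face, the far end would have the same
  -- parent, contradiction; on a face the weight `fw` is `1 − L/L = 0`
  have hx1 : ¬ blockReg (L * n) M S b'.1 := by
    intro h; apply hx; show S (blockOf n M (par n L M b'.1)); rw [blockOf_par]; exact h
  have hx2 : blockReg (L * n) M S (b'.1 + unitVec (fine (L * n) M) b'.2) := hb.resolve_left hx1
  have hf : L ∣ (b'.1 b'.2).val + 1 := by
    by_contra hf
    have hp : par n L M (b'.1 + unitVec (fine (L * n) M) b'.2) = par n L M b'.1 := by rw [par_add_unitVec, if_neg hf]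
    apply hx
    show S (blockOf n M (par n L M b'.1))
    rw [← hp, blockOf_par]
    exact hx2
  have hw : fw n L M b'.1 b'.2 = 0 := by
    have hL : (L : ℂ) ≠ 0 := by exact_mod_cast NeZero.ne L
    unfold fw
    rw [CellTaylorPlanting.val_rem_of_face n L M hf, Nat.cast_pred (Nat.pos_of_ne_zero (NeZero.ne L)), sub_add_cancel, div_self hL, sub_self]
  unfold fluxJ
  rw [hw, mul_zero, zero_mul, neg_zero]

/-- **THE FLUX** `hR ψ := (fluxJ n L M (∂ z))↾star′` on the fine star bonds. [folklore] -/
def hR (ψ : {x // blockReg n M S x} → ℂ) : {b // starReg (L * n) M S b} → ℂ := fun b' =>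
  fluxJ n L M (GradOp (fine n M) (n : ℂ) *ᵥ ext (blockReg n M S) ψ) b'.1

/-- the own-direction difference of the coarse gradient at an interior site is `n⁻¹` times the diagonal second difference:
`‖U(Y − e_ν, ν) − U(Y, ν)‖ = n⁻¹·‖(P_ν z)(Y)‖`. [folklore] -/
theorem norm_GradOp_backDiff_eq (z : Tor (fine n M) → ℂ) (Y : Tor (fine n M)) (ν : Fin d) :
    ‖(GradOp (fine n M) (n : ℂ) *ᵥ z) (Y - unitVec (fine n M) ν, ν) - (GradOp (fine n M) (n : ℂ) *ᵥ z) (Y, ν)‖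
      = (n : ℝ)⁻¹ * ‖(Pdir (fine n M) (n : ℂ) ν *ᵥ z) Y‖ := by
  have hn : (n : ℝ) ≠ 0 := by exact_mod_cast NeZero.ne n
  rw [GradOp_mulVec, GradOp_mulVec, sdiff_mulVec, sdiff_mulVec, Pdir_mulVec, sub_add_cancel, Complex.conj_natCast]
  have e : (n : ℂ) * (z Y - z (Y - unitVec (fine n M) ν)) - (n : ℂ) * (z (Y + unitVec (fine n M) ν) - z Y)
      = ((n : ℂ))⁻¹ * ((n : ℂ) * (n : ℂ) * (2 * z Y - z (Y + unitVec (fine n M) ν) - z (Y - unitVec (fine n M) ν))) := by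
    have hnc : (n : ℂ) ≠ 0 := by exact_mod_cast NeZero.ne n
    field_simp
    ring
  rw [e, norm_mul, norm_inv, Complex.norm_natCast]

/-- **THE SIZE OF THE FLUX**: `nsq (hR ψ) ≤ n⁻²·Hdiag n Ω z` — the interior diagonal Hessian of the zero extension over the region's sites
(gan24's `Hdiag`, bounded on a coordinate box by the compressed Laplacian, `hdiag_le_sum_normSq_LapS`). [folklore] -/
theorem nsq_hR_le (ψ : {x // blockReg n M S x} → ℂ) :
    nsq (hR n L M S ψ) ≤ ((n : ℝ) ^ 2)⁻¹ * Hdiag (n : ℂ) (univ.filter (blockReg n M S)) (ext (blockReg n M S) ψ) := by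
  have hRd : ‖cJ d L‖ ^ 2 * (L : ℝ) ^ d = 1 := norm_cJ_sq_mul (d := d) L
  set z := ext (blockReg n M S) ψ with hz
  set U := GradOp (fine n M) (n : ℂ) *ᵥ z with hU
  set F : Tor (fine (L * n) M) × Fin d → ℝ := fun b' =>
    if blockReg n M S (par n L M b'.1) then ‖cJ d L‖ ^ 2 * (((n : ℝ))⁻¹ * ‖(Pdir (fine n M) (n : ℂ) b'.2 *ᵥ z) (par n L M b'.1)‖) ^ 2 else 0
    with hF
  have hF0 : ∀ b', 0 ≤ F b' := fun b' => by rw [hF]; dsimp only; split_ifs <;> positivity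
  -- pointwise on the star bonds
  have hpt : ∀ b' : {b // starReg (L * n) M S b}, ‖hR n L M S ψ b'‖ ^ 2 ≤ F b'.1 := by
    intro b'
    unfold hR
    rw [hF]; dsimp only
    by_cases hx : blockReg n M S (par n L M b'.1.1)
    · rw [if_pos hx, ← norm_GradOp_backDiff_eq n M z, ← mul_pow]
      exact pow_le_pow_left₀ (norm_nonneg _) (norm_fluxJ_le n L M U b'.1) 2
    · rw [if_neg hx, fluxJ_eq_zero_of_exterior_cell n L M S U b'.2 hx, norm_zero]
      simp
  calc nsq (hR n L M S ψ) = ∑ b' : {b // starReg (L * n) M S b}, ‖hR n L M S ψ b'‖ ^ 2 := rfl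
    _ ≤ ∑ b' : {b // starReg (L * n) M S b}, F b'.1 := Finset.sum_le_sum fun b' _ => hpt b'
    _ ≤ ∑ b', F b' := sum_subtype_le_sum' (starReg (L * n) M S) (F := F) hF0
    _ = ∑ Y : Tor (fine n M), ∑ _j : Fin d → Fin L, ∑ ν,
          (if blockReg n M S Y then ‖cJ d L‖ ^ 2 * (((n : ℝ))⁻¹ * ‖(Pdir (fine n M) (n : ℂ) ν *ᵥ z) Y‖) ^ 2 else 0) := by
        rw [Fintype.sum_prod_type, sum_fine_eq_sum_tile_real n L M]
        refine Finset.sum_congr rfl fun Y _ => Finset.sum_congr rfl fun j _ => Finset.sum_congr rfl fun ν _ => ?_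
        rw [hF]; dsimp only; rw [par_cpt_add_off]
    _ = ∑ Y : Tor (fine n M), ∑ ν, (if blockReg n M S Y then (((n : ℝ))⁻¹ * ‖(Pdir (fine n M) (n : ℂ) ν *ᵥ z) Y‖) ^ 2 else 0) := by
        refine Finset.sum_congr rfl fun Y _ => ?_
        rw [Finset.sum_const, Finset.card_univ, Fintype.card_fun, Fintype.card_fin, Fintype.card_fin, nsmul_eq_mul, Nat.cast_pow,
          Finset.mul_sum]
        refine Finset.sum_congr rfl fun ν _ => ?_
        split_ifs
        · rw [← mul_assoc, mul_comm ((L : ℝ) ^ d), hRd, one_mul]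
        · rw [mul_zero]
    _ = ((n : ℝ) ^ 2)⁻¹ * Hdiag (n : ℂ) (univ.filter (blockReg n M S)) z := by
        unfold Hdiag
        rw [Finset.sum_comm, Finset.mul_sum]
        refine Finset.sum_congr rfl fun ν _ => ?_
        rw [Finset.sum_filter, Finset.mul_sum]
        refine Finset.sum_congr rfl fun Y _ => ?_
        split_ifs
        · rw [mul_pow, inv_pow]
        · rw [mul_zero]

end Summit.QuantumFields.BalabanUV.T4Continuum.RegionTaylorColumns

end
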